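import Summits.NavierStokesRegularity.FunctionalMining.NoGo.TopEigSaturatingKillBot
import Summits.NavierStokesRegularity.FunctionalMining.TopEigSaturatingKillNu
import HarnessLib

/-!
# FunctionalMining — LEMMA K in SCALING form, the mirror for the `−λ₃` rows `ES.neglam3.q | T_LD`

Search for candidate a priori estimates; no regularity claim. Cell `pub-nsfunc`, census-2 seat
(gen 41), staged as `pub-nsfunc-census-2/lean/lemmaK-B/v2/TopEigSaturatingKillNuBot.lean` (sha256
7440662a4fd9b031) and filed verbatim by the prove seat (gen 24; declarations byte-identical).
Companion of `TopEigSaturatingKillNu.lean` (the `λ₁` rows); imports it and the tree's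
`NoGo/TopEigSaturatingKillBot.lean` (no-go seat, door v2 §§6–7: `IsHeatMaxBotSelection`,
`selEulerProductionBot`, the doors `NegBotEigSelKillAt` / `NegBotEigSelKill`, and LEMMA K in
large-viscosity form). Refutation BOOKKEEPING for CANDIDATE a priori inequalities; nothing about
regularity; NO witness family is exhibited, and no row verdict is a kernel theorem by this file.

CONTENT (section numbers continue `TopEigSaturatingKillNu.lean`). §4 homogeneity of the bottom objects
under `w ↦ a • w`, `a > 0` (`Ψ_q`, its heat cost, the budget, heat-maximal bottom selections, the
bottom selection density and production `𝒫̃_q(a • w; e) = a^{q+1} 𝒫̃_q(w; e)`); §5 the fixed-viscosity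
door `NegBotEigSelKillAtNu q σ γ κ ν` and LEMMA K in scaling form for it
(`negBotEigSelKillAtNu_of_family`: for `1 + q/σ > 0`, no sign condition on `γ`, a family with a
production floor, bounded budgets and vanishing heat costs opens the door at EVERY `κ` and EVERY
`ν > 0`); §6 Lemma 0 (⇒) at one viscosity for `Ψ_q` and the kill at every fixed viscosity
(`not_negBotEigMoment_saturatingLawSupAt_of_family`, `q ≥ 1`), with the corollaries
`negBotEigSelKill_of_family_of_scaling`, `not_negBotEigMoment_saturatingLawSup_of_family_of_scaling`.
[ours, bookkeeping; QN4-NOTE LEMMA K (scaling form), SIEVELD §0 Lemma 0 (⇒)]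
-/

noncomputable section

open MeasureTheory Set Filter Topology

namespace Summit.NavierStokesRegularity.FunctionalMining

open Literature.Analysis.FunctionSpaces Literature.Analysis.FluidPDE

open TopEig

variable {d : Type*} [Fintype d] [DecidableEq d]

/-! ## 4. Homogeneity of the bottom objects (`Ψ_q = ∫((−λ₃)⁺)^q`, `ES.neglam3.q | T_LD`) -/

namespace TopEig

open StrainL4 StrainTensor

variable [Nonempty d]

/-- Heat-maximal bottom selections are preserved by positive amplitude scaling. [ours, bookkeeping] -/
theorem IsHeatMaxBotSelection.smul {w : UnitAddTorus d → EuclideanSpace ℝ d}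
    {e : UnitAddTorus d → d → ℝ} (he : IsHeatMaxBotSelection w e) {a : ℝ} (ha : 0 < a)
    (hw : Torus.IsSmooth w) : IsHeatMaxBotSelection (a • w) e where
  top x := by
    rw [strainFlat_smul (hw.isContDiff (by simp)) a x, ← smul_neg, topEigSet_smul_of_pos ha]
    exact he.top x
  heat x := by
    rw [laplacian_smul_of_isSmooth hw a, strainFlat_smul (hw.laplacian.isContDiff (by simp)) a x,
      strainFlat_smul (hw.isContDiff (by simp)) a x, ← smul_neg, ← smul_neg, quad_smul,
      dirTopEig_smul_left_of_pos ha, dirTopEig_smul_of_nonneg ha.le, he.heat x]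

/-- The bottom-selection production density scales like `a^{q+1}` (`a > 0`, smooth divergence-free
`w`). [ours, bookkeeping] -/
theorem selDensityBot_smul {q a : ℝ} (ha : 0 < a) {w : UnitAddTorus d → EuclideanSpace ℝ d}
    (hw : Torus.IsSmooth w) (hdw : Torus.IsDivFree w) (e : UnitAddTorus d → d → ℝ)
    (x : UnitAddTorus d) :
    q * (-torusStrainBotEig (a • w) x) ^ (q - 1) * quad (-eulerStrainVec (a • w) x) (e x) =
      a ^ (q + 1) * (q * (-torusStrainBotEig w x) ^ (q - 1) * quad (-eulerStrainVec w x) (e x)) := by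
  rw [rpow_neg_torusStrainBotEig_smul ha.le hw hdw (q - 1) x, eulerStrainVec_smul hw a x, ← smul_neg,
    quad_smul]
  have h : a ^ (q - 1) * a ^ 2 = a ^ (q + 1) := by
    rw [← Real.rpow_two, ← Real.rpow_add ha]; congr 1; ring
  linear_combination (q * (-torusStrainBotEig w x) ^ (q - 1) * quad (-eulerStrainVec w x) (e x)) * h

/-- Integrability of the bottom-selection production density is preserved by positive amplitude
scaling. [ours, bookkeeping] -/
theorem integrable_selDensityBot_smul {q a : ℝ} (ha : 0 < a)
    {w : UnitAddTorus d → EuclideanSpace ℝ d} (hw : Torus.IsSmooth w) (hdw : Torus.IsDivFree w)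
    {e : UnitAddTorus d → d → ℝ}
    (hint : Integrable (fun x => q * (-torusStrainBotEig w x) ^ (q - 1) *
      quad (-eulerStrainVec w x) (e x)) volume) :
    Integrable (fun x => q * (-torusStrainBotEig (a • w) x) ^ (q - 1) *
      quad (-eulerStrainVec (a • w) x) (e x)) volume := by
  have h : (fun x => q * (-torusStrainBotEig (a • w) x) ^ (q - 1) *
      quad (-eulerStrainVec (a • w) x) (e x)) =
      fun x => a ^ (q + 1) * (q * (-torusStrainBotEig w x) ^ (q - 1) *
        quad (-eulerStrainVec w x) (e x)) :=
    funext fun x => selDensityBot_smul ha hw hdw e x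
  rw [h]
  exact hint.const_mul _

/-- **The bottom-selection production is `(q+1)`-homogeneous**: `𝒫̃_q(a w; e) = a^{q+1} 𝒫̃_q(w; e)`
for `a > 0` and smooth divergence-free `w`. [ours, bookkeeping] -/
theorem selEulerProductionBot_smul (q : ℝ) {a : ℝ} (ha : 0 < a)
    {w : UnitAddTorus d → EuclideanSpace ℝ d} (hw : Torus.IsSmooth w) (hdw : Torus.IsDivFree w)
    (e : UnitAddTorus d → d → ℝ) :
    selEulerProductionBot q (a • w) e = a ^ (q + 1) * selEulerProductionBot q w e := by
  unfold selEulerProductionBot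
  rw [← integral_const_mul]
  exact integral_congr_ae (ae_of_all _ fun x => selDensityBot_smul ha hw hdw e x)

end TopEig

/-! ## 5. The fixed-viscosity door for the `−λ₃` rows, and LEMMA K in scaling form -/

/-- **The static door at one constant AND one viscosity** (`−λ₃` rows): the body of
`NegBotEigSelKillAt` with `ν` fixed. Nothing is asserted. [ours, bookkeeping] -/
def NegBotEigSelKillAtNu (q σ γ κ ν : ℝ) : Prop :=
  ∃ w : UnitAddTorus (Fin 3) → EuclideanSpace ℝ (Fin 3),
    Torus.IsSmooth w ∧ Torus.IsDivFree w ∧ Torus.HasZeroMean w ∧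
    ∃ e : UnitAddTorus (Fin 3) → Fin 3 → ℝ, IsHeatMaxBotSelection w e ∧
      Integrable (fun x => q * (-torusStrainBotEig w x) ^ (q - 1) *
        quad (-eulerStrainVec w x) (e x)) volume ∧
      κ * ν ^ (-γ) * (2 * torusEnstrophy w) * torusNegBotEigMoment q w ^ (1 + σ⁻¹) <
        selEulerProductionBot q w e - ν * heatDissipation (torusNegBotEigMoment q) w

/-- `NegBotEigSelKillAt` is the door at SOME viscosity `ν > 0`. [ours, bookkeeping] -/
theorem negBotEigSelKillAt_iff_exists_atNu {q σ γ κ : ℝ} :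
    NegBotEigSelKillAt q σ γ κ ↔ ∃ ν : ℝ, 0 < ν ∧ NegBotEigSelKillAtNu q σ γ κ ν :=
  Iff.rfl

/-- The fixed-viscosity door at some `ν > 0` opens `NegBotEigSelKillAt`. [ours, bookkeeping] -/
theorem negBotEigSelKillAt_of_atNu {q σ γ κ ν : ℝ} (hν : 0 < ν) (h : NegBotEigSelKillAtNu q σ γ κ ν) :
    NegBotEigSelKillAt q σ γ κ :=
  ⟨ν, hν, h⟩

section LemmaKScaling

variable {ι : Type*}

/-- **LEMMA K for the `−λ₃` rows, SCALING form (fixed viscosity).** As `topEigSelKillAtNu_of_family`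
with heat-maximal bottom selections, the production `𝒫̃_q`, the weight `Ψ_q` and its heat dissipation:
`1 + q/σ > 0` and (K-a)–(K-c) give `NegBotEigSelKillAtNu q σ γ κ ν` for EVERY real `κ` and EVERY
`ν > 0`. No sign condition on `γ`; nothing is exhibited. [ours; QN4-NOTE LEMMA K, scaling form] -/
theorem negBotEigSelKillAtNu_of_family {q σ γ c B : ℝ} (hθ : 0 < 1 + σ⁻¹ * q) (hc : 0 < c)
    {w : ι → UnitAddTorus (Fin 3) → EuclideanSpace ℝ (Fin 3)} {e : ι → UnitAddTorus (Fin 3) → Fin 3 → ℝ}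
    (hw : ∀ i, Torus.IsSmooth (w i)) (hdw : ∀ i, Torus.IsDivFree (w i))
    (hmean : ∀ i, Torus.HasZeroMean (w i)) (he : ∀ i, IsHeatMaxBotSelection (w i) (e i))
    (hint : ∀ i, Integrable (fun x => q * (-torusStrainBotEig (w i) x) ^ (q - 1) *
      quad (-eulerStrainVec (w i) x) (e i x)) volume)
    (hprod : ∀ i, c ≤ selEulerProductionBot q (w i) (e i))
    (hbud : ∀ i, 2 * torusEnstrophy (w i) * torusNegBotEigMoment q (w i) ^ (1 + σ⁻¹) ≤ B)
    (hheat : ∀ ε : ℝ, 0 < ε → ∃ i, heatDissipation (torusNegBotEigMoment q) (w i) ≤ ε)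
    (κ : ℝ) {ν : ℝ} (hν : 0 < ν) : NegBotEigSelKillAtNu q σ γ κ ν := by
  obtain ⟨a, ha, -, i, hlt⟩ := exists_scale_budget_lt_of_family (K := κ * ν ^ (-γ)) hθ hc hν
    (b := fun i => 2 * torusEnstrophy (w i) * torusNegBotEigMoment q (w i) ^ (1 + σ⁻¹))
    (P := fun i => selEulerProductionBot q (w i) (e i))
    (H := fun i => heatDissipation (torusNegBotEigMoment q) (w i))
    (fun i => mul_nonneg (mul_nonneg two_pos.le (torusEnstrophy_nonneg _))
      (Real.rpow_nonneg (torusNegBotEigMoment_nonneg q _) _)) hbud hprod hheat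
  refine ⟨a • w i, (hw i).smul a, isDivFree_const_smul ((hw i).isContDiff (by simp)) (hdw i) a,
    hasZeroMean_const_smul (hmean i) a, e i, (he i).smul ha (hw i),
    integrable_selDensityBot_smul ha (hw i) (hdw i) (hint i), ?_⟩
  rw [mul_assoc (κ * ν ^ (-γ)), enstrophy_negBotEigMoment_budget_smul q σ ha (hw i),
    selEulerProductionBot_smul q ha (hw i) (hdw i) (e i), heatDissipation_negBotEigMoment_smul q ha (hw i)]
  have h1 : a ^ (2 + q * (1 + σ⁻¹)) = a ^ (q + 1) * a ^ (1 + σ⁻¹ * q) := by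
    rw [← Real.rpow_add ha]; congr 1; ring
  have h2 : a ^ q = a ^ (q + 1) * a⁻¹ := by
    rw [← Real.rpow_neg_one, ← Real.rpow_add ha]; congr 1; ring
  rw [h1, h2]
  have hpos : 0 < a ^ (q + 1) := Real.rpow_pos_of_pos ha _
  have key := mul_lt_mul_of_pos_left hlt hpos
  linarith [key]

/-- **LEMMA K (scaling form) gives the `−λ₃` door for every constant** without a sign condition on
`γ`: under the hypotheses of `negBotEigSelKillAtNu_of_family`, `NegBotEigSelKill q σ γ`. [ours] -/
theorem negBotEigSelKill_of_family_of_scaling {q σ γ c B : ℝ} (hθ : 0 < 1 + σ⁻¹ * q) (hc : 0 < c)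
    {w : ι → UnitAddTorus (Fin 3) → EuclideanSpace ℝ (Fin 3)} {e : ι → UnitAddTorus (Fin 3) → Fin 3 → ℝ}
    (hw : ∀ i, Torus.IsSmooth (w i)) (hdw : ∀ i, Torus.IsDivFree (w i))
    (hmean : ∀ i, Torus.HasZeroMean (w i)) (he : ∀ i, IsHeatMaxBotSelection (w i) (e i))
    (hint : ∀ i, Integrable (fun x => q * (-torusStrainBotEig (w i) x) ^ (q - 1) *
      quad (-eulerStrainVec (w i) x) (e i x)) volume)
    (hprod : ∀ i, c ≤ selEulerProductionBot q (w i) (e i))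
    (hbud : ∀ i, 2 * torusEnstrophy (w i) * torusNegBotEigMoment q (w i) ^ (1 + σ⁻¹) ≤ B)
    (hheat : ∀ ε : ℝ, 0 < ε → ∃ i, heatDissipation (torusNegBotEigMoment q) (w i) ≤ ε) :
    NegBotEigSelKill q σ γ := fun κ =>
  negBotEigSelKillAt_of_atNu one_pos
    (negBotEigSelKillAtNu_of_family hθ hc hw hdw hmean he hint hprod hbud hheat κ one_pos)

end LemmaKScaling

/-! ## 6. Lemma 0 (⇒) at one viscosity for the `−λ₃` rows, and the kill at EVERY fixed viscosity -/

/-- **The static necessary condition for the `−λ₃` rows at ONE viscosity.** Under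
`SaturatingLawSupAt ν Ψ_q σ γ κ` on `T³` (`q ≥ 1`, `ν > 0`): at every smooth divergence-free zero-mean
datum `w` and every heat-maximal bottom selection `e` with integrable production density,
`𝒫̃_q(w; e) − ν · heatDissipation Ψ_q w ≤ κ ν^{−γ} (2ℰ w) Ψ_q(w)^{1+1/σ}`. [ours] -/
theorem SaturatingLawSupAt.selEulerProductionBot_sub_heat_le {q σ γ κ ν : ℝ} (hq : 1 ≤ q)
    (hd : Fintype.card d = 3)
    (h : SaturatingLawSupAt (d := d) ν (torusNegBotEigMoment q) σ γ κ) (hν : 0 < ν)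
    {w : UnitAddTorus d → EuclideanSpace ℝ d} (hw : Torus.IsSmooth w) (hdw : Torus.IsDivFree w)
    (hmean : Torus.HasZeroMean w) {e : UnitAddTorus d → d → ℝ} (he : IsHeatMaxBotSelection w e)
    (hint : Integrable (fun x => q * (-torusStrainBotEig w x) ^ (q - 1) *
      quad (-eulerStrainVec w x) (e x)) volume) :
    selEulerProductionBot q w e - ν * heatDissipation (torusNegBotEigMoment q) w ≤
      κ * ν ^ (-γ) * (2 * torusEnstrophy w) * torusNegBotEigMoment q w ^ (1 + σ⁻¹) := by
  haveI : Nonempty d := Fintype.card_pos_iff.1 (by omega)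
  refine h.lowerRate_le hd hν hw hdw hmean fun T hT u p hsol hu0 _ => ?_
  subst hu0
  exact selEulerProductionBot_sub_heat_le_initialRate hq hT hsol he hint

/-- **Fixed-viscosity door ⇒ kill at that viscosity** (`−λ₃` rows):
`NegBotEigSelKillAtNu q σ γ κ ν → ¬ SaturatingLawSupAt ν Ψ_q σ γ κ` on `T³` (`q ≥ 1`, `ν > 0`).
Refutation bookkeeping for a CANDIDATE inequality; nothing about regularity. [ours] -/
theorem not_negBotEigMoment_saturatingLawSupAt_of_selKillAtNu {q σ γ κ ν : ℝ} (hq : 1 ≤ q)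
    (hν : 0 < ν) (hK : NegBotEigSelKillAtNu q σ γ κ ν) :
    ¬ SaturatingLawSupAt (d := Fin 3) ν (torusNegBotEigMoment q) σ γ κ := by
  intro hlaw
  obtain ⟨w, hw, hdw, hmean, e, he, hint, hlt⟩ := hK
  exact (not_le.2 hlt) (hlaw.selEulerProductionBot_sub_heat_le hq (by simp) hν hw hdw hmean he hint)

section LemmaKScaling

variable {ι : Type*}

/-- **A family kills the `−λ₃` law at EVERY FIXED viscosity and EVERY constant**: under the
hypotheses of `negBotEigSelKillAtNu_of_family` and `q ≥ 1`, `¬ SaturatingLawSupAt ν Ψ_q σ γ κ` on `T³`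
for every real `κ` and every `ν > 0`. Refutation bookkeeping; nothing about regularity; no family is
exhibited. [ours] -/
theorem not_negBotEigMoment_saturatingLawSupAt_of_family {q σ γ c B : ℝ} (hq : 1 ≤ q)
    (hθ : 0 < 1 + σ⁻¹ * q) (hc : 0 < c)
    {w : ι → UnitAddTorus (Fin 3) → EuclideanSpace ℝ (Fin 3)} {e : ι → UnitAddTorus (Fin 3) → Fin 3 → ℝ}
    (hw : ∀ i, Torus.IsSmooth (w i)) (hdw : ∀ i, Torus.IsDivFree (w i))
    (hmean : ∀ i, Torus.HasZeroMean (w i)) (he : ∀ i, IsHeatMaxBotSelection (w i) (e i))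
    (hint : ∀ i, Integrable (fun x => q * (-torusStrainBotEig (w i) x) ^ (q - 1) *
      quad (-eulerStrainVec (w i) x) (e i x)) volume)
    (hprod : ∀ i, c ≤ selEulerProductionBot q (w i) (e i))
    (hbud : ∀ i, 2 * torusEnstrophy (w i) * torusNegBotEigMoment q (w i) ^ (1 + σ⁻¹) ≤ B)
    (hheat : ∀ ε : ℝ, 0 < ε → ∃ i, heatDissipation (torusNegBotEigMoment q) (w i) ≤ ε)
    (κ : ℝ) {ν : ℝ} (hν : 0 < ν) :
    ¬ SaturatingLawSupAt (d := Fin 3) ν (torusNegBotEigMoment q) σ γ κ :=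
  not_negBotEigMoment_saturatingLawSupAt_of_selKillAtNu hq hν
    (negBotEigSelKillAtNu_of_family hθ hc hw hdw hmean he hint hprod hbud hheat κ hν)

/-- **A family kills the `−λ₃` law for every constant, scaling form** (no sign condition on `γ`):
under the hypotheses of `negBotEigSelKillAtNu_of_family` and `q ≥ 1`, `¬ SaturatingLawSup Ψ_q σ γ κ`
on `T³` for EVERY real `κ`. Nothing is exhibited. [ours] -/
theorem not_negBotEigMoment_saturatingLawSup_of_family_of_scaling {q σ γ c B : ℝ} (hq : 1 ≤ q)
    (hθ : 0 < 1 + σ⁻¹ * q) (hc : 0 < c)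
    {w : ι → UnitAddTorus (Fin 3) → EuclideanSpace ℝ (Fin 3)} {e : ι → UnitAddTorus (Fin 3) → Fin 3 → ℝ}
    (hw : ∀ i, Torus.IsSmooth (w i)) (hdw : ∀ i, Torus.IsDivFree (w i))
    (hmean : ∀ i, Torus.HasZeroMean (w i)) (he : ∀ i, IsHeatMaxBotSelection (w i) (e i))
    (hint : ∀ i, Integrable (fun x => q * (-torusStrainBotEig (w i) x) ^ (q - 1) *
      quad (-eulerStrainVec (w i) x) (e i x)) volume)
    (hprod : ∀ i, c ≤ selEulerProductionBot q (w i) (e i))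
    (hbud : ∀ i, 2 * torusEnstrophy (w i) * torusNegBotEigMoment q (w i) ^ (1 + σ⁻¹) ≤ B)
    (hheat : ∀ ε : ℝ, 0 < ε → ∃ i, heatDissipation (torusNegBotEigMoment q) (w i) ≤ ε) (κ : ℝ) :
    ¬ SaturatingLawSup (d := Fin 3) (torusNegBotEigMoment q) σ γ κ :=
  not_negBotEigMoment_saturatingLawSup_of_selKill hq
    (negBotEigSelKill_of_family_of_scaling hθ hc hw hdw hmean he hint hprod hbud hheat) κ

end LemmaKScaling

end Summit.NavierStokesRegularity.FunctionalMining

end
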